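import Mathlib

/-!
# SEIL-F outer end: the exact adiabatic (frozen-frame) error formula (solo-blind s85, kernel #192)

LEMMA R, piece (R0) (PLAN §107 (g)): the slow frame `V` of the deleted leaf chain solves a
forced linear evolution, and its leading order is the FROZEN frame `W(t) = -(D(t) - λ)⁻¹ f(t)`
(in angle space: the bulk law `-(hₓ/h) sin²θ/cos θ` plus the Scorer layer, kernels #190/#191).
The error `E = V - W` is driven only by the slow drift `Ẇ` of the frozen frame.  This file
records the exact discrete version (one step = one propagator `A n`, e.g. one sweep of the
time grid or one period): if `V (n+1) = A n * V n + f n` and `W n` is the frozen fixed point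
`W n = A n * W n + f n`, then

* `adiabatic_error_step`:  `E (n+1) = A n * E n - (W (n+1) - W n)`;
* `adiabatic_error_sum`:   `E n = U n 0 * E 0 - Σ_{k<n} U n (k+1) * (W (k+1) - W k)`
  for any propagator family `U` with `U n n = 1`, `U (n+1) k = A n * U n k` (`k ≤ n`).

So `‖V - W‖` is bounded by (propagator mass) × (total variation of the frozen frame), with no
transient constant of the frozen generators entering — the form used with the Kelvin-mode
propagator bounds of kernel #189.  Stated over an arbitrary ring (operators; noncommutative).
-/

namespace Summit.AnomalousDissipation.AnomalousDissipation.Theorems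

open Finset

variable {R : Type*} [Ring R]

/-- One-step recursion of the adiabatic error. -/
theorem adiabatic_error_step (A f V W : ℕ → R)
    (hV : ∀ n, V (n + 1) = A n * V n + f n) (hW : ∀ n, W n = A n * W n + f n) (n : ℕ) :
    V (n + 1) - W (n + 1) = A n * (V n - W n) - (W (n + 1) - W n) := by
  rw [hV n, mul_sub]
  have h := hW n
  -- A n * W n = W n - f n
  have h' : A n * W n = W n - f n := by rw [eq_sub_iff_add_eq]; exact h.symm
  rw [h']
  abel

/-- Summed form: the error is the propagated initial error minus the propagated increments of
the frozen frame. -/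
theorem adiabatic_error_sum (A f V W : ℕ → R) (U : ℕ → ℕ → R)
    (hV : ∀ n, V (n + 1) = A n * V n + f n) (hW : ∀ n, W n = A n * W n + f n)
    (hU0 : ∀ n, U n n = 1) (hU : ∀ n k, k ≤ n → U (n + 1) k = A n * U n k) (n : ℕ) :
    V n - W n = U n 0 * (V 0 - W 0) - ∑ k ∈ range n, U n (k + 1) * (W (k + 1) - W k) := by
  induction n with
  | zero => simp [hU0]
  | succ n ih =>
    rw [adiabatic_error_step A f V W hV hW n, ih, mul_sub, ← mul_assoc, ← hU n 0 (Nat.zero_le n),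
      mul_sum, sum_range_succ, hU0, one_mul]
    have : ∑ k ∈ range n, A n * (U n (k + 1) * (W (k + 1) - W k))
        = ∑ k ∈ range n, U (n + 1) (k + 1) * (W (k + 1) - W k) := by
      refine sum_congr rfl fun k hk => ?_
      rw [← mul_assoc, ← hU n (k + 1) (by simpa using mem_range.mp hk)]
    rw [this]
    abel

/-- Consequence for a stationary frozen frame: if `W` does not drift, the error is just the
propagated initial error (the frame IS the frozen frame up to transients). -/
theorem adiabatic_error_static (A f V W : ℕ → R) (U : ℕ → ℕ → R)
    (hV : ∀ n, V (n + 1) = A n * V n + f n) (hW : ∀ n, W n = A n * W n + f n)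
    (hU0 : ∀ n, U n n = 1) (hU : ∀ n k, k ≤ n → U (n + 1) k = A n * U n k)
    (hstat : ∀ n, W (n + 1) = W n) (n : ℕ) :
    V n - W n = U n 0 * (V 0 - W 0) := by
  rw [adiabatic_error_sum A f V W U hV hW hU0 hU n]
  simp [hstat]

end Summit.AnomalousDissipation.AnomalousDissipation.Theorems
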